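import Summits.RiemannHypothesis.RiemannHypothesis.Theses.GapsEvoDoors
import Literature.NumberTheory.LFunctions.ZetaSpacingDensitySelbergMinorant

/-!
# GapsEvoDoors — `DeltaCIFinite` (item stmt-RiemannHypothesis-22421): a closed-form witness

The door-(a) search object `DeltaCIFinite` of route `GapsEvoDoors` asks for SOME window `Δ ≥ 1`,
slack `ε > 0`, `0 < λ < 1/2` and a test function `r` (even, continuous, `L¹`, `r̂ ∈ L¹`, `r ≤ 1`,
`r ≤ 0` off `[−λ, λ]`, `r̂ ≥ 0` for `|α| ≥ Δ`) with positive two-sided certificate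
`c(r; Δ, ε) = r̂(0) − 1 + 2∫₀¹ α r̂ + 2∫₁^Δ ((1 − ε) r̂⁺ − (1 + ε) r̂⁻) > 0`.

We close it with an EXPLICIT witness made of tree objects (the refuter-critic's candidate of record,
evidence `DeltaCIFinite_witness.py` on the item): the dilated Bui–Goldston–Milinovich–Montgomery
Selberg minorant `r = R(·/λ)`, `R(x) = (sin πx/πx)²/(1 − x²)` (tree file
`Literature/NumberTheory/LFunctions/ZetaSpacingDensitySelbergMinorant.lean`: `R(·/λ) ∈ 𝒜(λ)`,
`r̂(α) = λ R̂(λα)`, `R̂(t) = (1 − |t|)₊ + 𝟙_{|t| ≤ 1} sin(2π|t|)/2π ≥ 0`, supported in `[−1, 1]`,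
`|R| ≤ 1`, and the closed form of `c(λ; r) = r̂(0) − 1 + 2∫₀¹ α r̂`), at
`(Δ, ε, λ) = (100/49, 1/20, 49/100)`. Since `r̂ ≥ 0` everywhere, `r̂⁺ = r̂`, `r̂⁻ = 0`, and
`∫₁^{1/λ} r̂ = ∫_λ^1 R̂ = (1 − λ)²/2 + (cos 2πλ − 1)/(4π²)` (FTC), so
`c = [λ − 1 + 2λ(1/2 − λ/3 + (sin 2πλ − 2πλ cos 2πλ)/(2π(2πλ)²))] + 2(1 − ε)[(1 − λ)²/2 + (cos 2πλ − 1)/(4π²)]`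
`= −0.12847… + 0.15093… = +0.0225 > 0`; the kernel inequality uses only `sin(π/50) ≥ 0`,
`1 − θ²/2 ≤ cos θ ≤ 1` at `θ = π/50`, and `π > 3` (certified margin `> 0.0169`).

This is NOT the cell's extremiser of record (eng-2 PW-SOS `W₂` at `(3/2, 1/20, 99/200)`, eng-1 HG at
`(7/5, 1/20, 0.4999)`, Fejér triangle at `(8, 1/20, 0.499)`; PREREG-GAPS-0 §A.5, referee V-9…V-16):
the typed statement is a pure `∃`, and any certified member closes it; the window `100/49 ≈ 2.04`
is an UPPER bound for the cell's `Δ_CI(1/20) ≈ 1.38`. RH-sentence (c): a record INSIDE route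
GapsEvoDoors (the `∃`-stub of crux `FragmentToCI`, i.e. conditional `Δ_CI` bookkeeping) — toward
RiemannHypothesis: 0. computed ≠ proved outside this kernel theorem; nothing here bears on the truth
of RH.
-/

noncomputable section

open MeasureTheory Set Real Literature.NumberTheory.LFunctions

open scoped Real Interval

set_option linter.dupNamespace false  -- the mandated namespace repeats `RiemannHypothesis`

namespace Summit.RiemannHypothesis.RiemannHypothesis.Theorems.GapsEvoDoorsDeltaCI

/-! ### 1. `∫_λ^1 R̂ = (1 − λ)²/2 + (cos 2πλ − 1)/(4π²)` and `∫₁^{1/λ} r̂` for `r = R(·/λ)` -/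

/-- `∫_λ^1 R̂(t) dt = (1 − λ)²/2 + (cos 2πλ − 1)/(4π²)` for `0 ≤ λ ≤ 1`, where
`R̂(t) = (1 − |t|)₊ + 𝟙_{|t| ≤ 1} sin(2π|t|)/2π` is the Fourier transform of the BGMM Selberg minorant
(on `[λ, 1]` it is `1 − t + sin(2πt)/2π`; antiderivative `t − t²/2 − cos(2πt)/(4π²)`). -/
theorem integral_selbergHat_of_le_one {lam : ℝ} (h0 : 0 ≤ lam) (h1 : lam ≤ 1) :
    ∫ t in lam..1, (max (1 - |t|) 0 + (if |t| ≤ 1 then Real.sin (2 * π * |t|) / (2 * π) else 0)) =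
      (1 - lam) ^ 2 / 2 + (Real.cos (2 * π * lam) - 1) / (4 * π ^ 2) := by
  have hcongr : ∫ t in lam..1, (max (1 - |t|) 0 +
        (if |t| ≤ 1 then Real.sin (2 * π * |t|) / (2 * π) else 0)) =
      ∫ t in lam..1, (1 - t + Real.sin (2 * π * t) / (2 * π)) := by
    refine intervalIntegral.integral_congr fun t ht ↦ ?_
    rw [Set.uIcc_of_le h1, Set.mem_Icc] at ht
    have ht0 : 0 ≤ t := h0.trans ht.1
    rw [BGMM2023.selbergHat_of_abs_le_one (by rw [abs_of_nonneg ht0]; exact ht.2), abs_of_nonneg ht0]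
  rw [hcongr]
  have hderiv : ∀ t ∈ Set.uIcc lam 1,
      HasDerivAt (fun t : ℝ ↦ t - t ^ 2 / 2 - Real.cos (2 * π * t) / (4 * π ^ 2))
        (1 - t + Real.sin (2 * π * t) / (2 * π)) t := by
    intro t _
    have hl : HasDerivAt (fun t : ℝ ↦ 2 * π * t) (2 * π) t := by
      simpa using (hasDerivAt_id t).const_mul (2 * π)
    have hC : HasDerivAt (fun t : ℝ ↦ Real.cos (2 * π * t)) (-Real.sin (2 * π * t) * (2 * π)) t :=
      hl.cos
    have h := ((hasDerivAt_id' t).fun_sub ((hasDerivAt_pow 2 t).div_const 2)).fun_sub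
      (hC.div_const (4 * π ^ 2))
    refine h.congr_deriv ?_
    have hπ : π ≠ 0 := Real.pi_ne_zero
    push_cast
    field_simp
    ring
  have hint : IntervalIntegrable (fun t : ℝ ↦ 1 - t + Real.sin (2 * π * t) / (2 * π)) volume lam 1 :=
    (by fun_prop : Continuous fun t : ℝ ↦ 1 - t + Real.sin (2 * π * t) / (2 * π)).intervalIntegrable _ _
  rw [intervalIntegral.integral_eq_sub_of_hasDerivAt hderiv hint]
  simp only [mul_one, one_pow, Real.cos_two_pi]
  ring

/-- `∫₁^{1/λ} r̂(α) dα = (1 − λ)²/2 + (cos 2πλ − 1)/(4π²)` for `r = R(·/λ)`, `0 < λ ≤ 1`: by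
`r̂(α) = λR̂(λα)` (tree `BGMM2023.cosTransform_selbergMinorant_div`) and the substitution `t = λα`. -/
theorem integral_cosTransform_selbergMinorant_div {lam : ℝ} (h0 : 0 < lam) (h1 : lam ≤ 1) :
    ∫ α in (1 : ℝ)..(1 / lam), BGMM2023.cosTransform
        (fun u : ℝ ↦ Real.sinc (π * (u / lam)) ^ 2 / (1 - (u / lam) ^ 2)) α =
      (1 - lam) ^ 2 / 2 + (Real.cos (2 * π * lam) - 1) / (4 * π ^ 2) := by
  simp_rw [BGMM2023.cosTransform_selbergMinorant_div h0]
  rw [intervalIntegral.integral_const_mul]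
  have hsub := intervalIntegral.integral_comp_mul_left (a := (1 : ℝ)) (b := 1 / lam)
    (fun t : ℝ ↦ max (1 - |t|) 0 + (if |t| ≤ 1 then Real.sin (2 * π * |t|) / (2 * π) else 0)) h0.ne'
  rw [mul_one, mul_one_div_cancel h0.ne', smul_eq_mul] at hsub
  rw [hsub, ← mul_assoc, mul_inv_cancel₀ h0.ne', one_mul]
  exact integral_selbergHat_of_le_one h0.le h1

/-! ### 2. The certified inequality at `(Δ, ε, λ) = (100/49, 1/20, 49/100)` -/

/-- **The certificate is positive**: with `λ = 49/100`, `ε = 1/20`,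
`[λ − 1 + 2λ(1/2 − λ/3 + (sin 2πλ − 2πλ cos 2πλ)/(2π(2πλ)²))] + 2(1 − ε)[(1 − λ)²/2 + (cos 2πλ − 1)/(4π²)] > 0`
(`≈ 0.0225`). Proof: `2πλ = π − θ`, `θ = π/50`; `sin θ ≥ 0`, `1 − θ²/2 ≤ cos θ ≤ 1` give the lower bound
`40157/600000 − 9/(20π²) > 0.0169` using only `π > 3`. -/
theorem certificate_pos :
    0 < (49 / 100 : ℝ) - 1 + 2 * (49 / 100 * (1 / 2 - 49 / 100 / 3 +
      (Real.sin (2 * π * (49 / 100)) - 2 * π * (49 / 100) * Real.cos (2 * π * (49 / 100))) /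
        (2 * π * (2 * π * (49 / 100)) ^ 2))) +
      2 * ((1 - 1 / 20) * ((1 - 49 / 100) ^ 2 / 2 +
        (Real.cos (2 * π * (49 / 100)) - 1) / (4 * π ^ 2))) := by
  have h2 : 2 * π * (49 / 100 : ℝ) = π - π / 50 := by ring
  rw [h2, Real.sin_pi_sub, Real.cos_pi_sub]
  have hπ := Real.pi_gt_three
  have hπpos := Real.pi_pos
  have hπne : π ≠ 0 := Real.pi_ne_zero
  have hθ0 : 0 ≤ π / 50 := by positivity
  have hθπ : π / 50 ≤ π := by linarith
  have hpt : 0 < π - π / 50 := by linarith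
  have hsin : 0 ≤ Real.sin (π / 50) := Real.sin_nonneg_of_nonneg_of_le_pi hθ0 hθπ
  have hcos : 1 - (π / 50) ^ 2 / 2 ≤ Real.cos (π / 50) := Real.one_sub_sq_div_two_le_cos
  have hcos1 : Real.cos (π / 50) ≤ 1 := Real.cos_le_one _
  have hD : 0 < 2 * π * (π - π / 50) ^ 2 := by positivity
  -- the first fraction is at least `(1 − θ²/2)/(2π(π − θ)) = 25/(49π²) − 1/9800`
  have hN : (π - π / 50) * (1 - (π / 50) ^ 2 / 2) ≤
      Real.sin (π / 50) - (π - π / 50) * -Real.cos (π / 50) := by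
    have := mul_le_mul_of_nonneg_left hcos hpt.le
    linarith
  have hX : (π - π / 50) * (1 - (π / 50) ^ 2 / 2) / (2 * π * (π - π / 50) ^ 2) ≤
      (Real.sin (π / 50) - (π - π / 50) * -Real.cos (π / 50)) / (2 * π * (π - π / 50) ^ 2) :=
    div_le_div_of_nonneg_right hN hD.le
  have e1 : (π - π / 50) * (1 - (π / 50) ^ 2 / 2) / (2 * π * (π - π / 50) ^ 2) =
      25 / 49 * (1 / π ^ 2) - 1 / 9800 := by
    have h49 : π - π / 50 = 49 / 50 * π := by ring
    rw [h49]
    field_simp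
    ring
  -- the second fraction is at least `−1/(2π²)`
  have hC : (-1 - 1) / (4 * π ^ 2) ≤ (-Real.cos (π / 50) - 1) / (4 * π ^ 2) :=
    div_le_div_of_nonneg_right (by linarith) (by positivity)
  have e2 : (-1 - 1 : ℝ) / (4 * π ^ 2) = -(1 / 2) * (1 / π ^ 2) := by
    field_simp
    ring
  have hq : 1 / π ^ 2 ≤ 1 / 9 := by
    apply one_div_le_one_div_of_le (by norm_num)
    nlinarith
  have hq0 : 0 ≤ 1 / π ^ 2 := by positivity
  rw [e1] at hX
  rw [e2] at hC
  linarith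

/-! ### 3. The item -/

/-- **`DeltaCIFinite` holds** (item stmt-RiemannHypothesis-22421 of route GapsEvoDoors), witnessed by
`(Δ, ε, λ) = (100/49, 1/20, 49/100)` and `r = R(·/λ)`, `R(x) = (sin πx/πx)²/(1 − x²)` the BGMM 2023
Selberg minorant: `r ∈ 𝒜(λ)` (even, continuous, `L¹`, `r ≤ |R| ≤ 1`, `r ≤ 0` off `[−λ, λ]`,
`r̂ = λR̂(λ·) ≥ 0` everywhere, hence `r̂ ∈ L¹` by the tree's Gaussian-regularisation lemma), and
certificate `c(r; 100/49, 1/20) ≈ 0.0225 > 0` (`certificate_pos`). A record INSIDE the route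
(∃-stub of the crux `FragmentToCI`); toward RiemannHypothesis: 0. -/
theorem DeltaCIFinite_holds :
    Summit.RiemannHypothesis.RiemannHypothesis.Theses.GapsEvoDoors.DeltaCIFinite := by
  unfold Summit.RiemannHypothesis.RiemannHypothesis.Theses.GapsEvoDoors.DeltaCIFinite
  have h0 : (0 : ℝ) < 49 / 100 := by norm_num
  have h1 : (49 / 100 : ℝ) ≤ 1 := by norm_num
  have hadm := BGMM2023.isAdmissible_selbergMinorant_div h0
  refine ⟨100 / 49, 1 / 20, 49 / 100,
    fun u : ℝ ↦ Real.sinc (π * (u / (49 / 100))) ^ 2 / (1 - (u / (49 / 100)) ^ 2),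
    by norm_num, by norm_num, h0, by norm_num, hadm.even, hadm.continuous, hadm.integrable,
    BGMM2023.integrable_cosTransform hadm.continuous hadm.integrable hadm.even hadm.transform_nonneg,
    fun u ↦ (le_abs_self _).trans (BGMM2023.abs_selbergMinorant_le_one _), hadm.nonpos,
    fun α _ ↦ hadm.transform_nonneg α, ?_⟩
  -- `r̂(0) − 1 + 2∫₀¹ α r̂ = c(λ; r)` in closed form (tree)
  have hcv := BGMM2023.cValue_selbergMinorant_div_of_le_one h0 h1
  unfold BGMM2023.cValue at hcv
  -- the window integral: `r̂ ≥ 0`, so the integrand is `(1 − ε) r̂`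
  have hI : (∫ α in (1 : ℝ)..(100 / 49), ((1 - 1 / 20) * max (BGMM2023.cosTransform
        (fun u : ℝ ↦ Real.sinc (π * (u / (49 / 100))) ^ 2 / (1 - (u / (49 / 100)) ^ 2)) α) 0 -
      (1 + 1 / 20) * max (-BGMM2023.cosTransform
        (fun u : ℝ ↦ Real.sinc (π * (u / (49 / 100))) ^ 2 / (1 - (u / (49 / 100)) ^ 2)) α) 0)) =
      (1 - 1 / 20) * ((1 - 49 / 100) ^ 2 / 2 + (Real.cos (2 * π * (49 / 100)) - 1) / (4 * π ^ 2)) := by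
    have hnn := hadm.transform_nonneg
    have hcongr : (∫ α in (1 : ℝ)..(100 / 49), ((1 - 1 / 20) * max (BGMM2023.cosTransform
        (fun u : ℝ ↦ Real.sinc (π * (u / (49 / 100))) ^ 2 / (1 - (u / (49 / 100)) ^ 2)) α) 0 -
      (1 + 1 / 20) * max (-BGMM2023.cosTransform
        (fun u : ℝ ↦ Real.sinc (π * (u / (49 / 100))) ^ 2 / (1 - (u / (49 / 100)) ^ 2)) α) 0)) =
        ∫ α in (1 : ℝ)..(100 / 49), (1 - 1 / 20) * BGMM2023.cosTransform
          (fun u : ℝ ↦ Real.sinc (π * (u / (49 / 100))) ^ 2 / (1 - (u / (49 / 100)) ^ 2)) α := by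
      refine intervalIntegral.integral_congr fun α _ ↦ ?_
      have hα := hnn α
      rw [max_eq_left hα, max_eq_right (by linarith), mul_zero, sub_zero]
    rw [hcongr, intervalIntegral.integral_const_mul,
      show (100 / 49 : ℝ) = 1 / (49 / 100) by norm_num,
      integral_cosTransform_selbergMinorant_div h0 h1]
  rw [hcv, hI]
  exact certificate_pos

end Summit.RiemannHypothesis.RiemannHypothesis.Theorems.GapsEvoDoorsDeltaCI

end
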